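import Mathlib.Data.Matrix.Mul
import Mathlib.Data.ZMod.Basic
import Mathlib.GroupTheory.Index
import Mathlib.Tactic.Abel
import HarnessLib

/-!
# The dual-attack lattice of an LWE instance and the distinguishing identity `xᵗb = yᵗs + xᵗe`

Topic `Computability/Cryptography`. The CRYSTALS-Kyber specification (v3.02), §5.1.3 "Dual attack"
(p. 26), verbatim:

> "The dual attack consists of finding a short vector in the dual lattice `w ∈ Λ′ = {(x, y) ∈ ℤ^m × ℤ^{kn} :
> Aᵗx = y mod q}`. Assume we have found a vector `(x, y)` of length `ℓ` and compute
> `z = vᵗ·b = vᵗAs + vᵗe = wᵗs + vᵗe mod q`, which is distributed as a Gaussian of standard deviation `ℓς`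
> if `(A, b)` is indeed an LWE sample (otherwise it is uniform mod `q`). […] Knowing that `Λ′` has
> dimension `d = m + kn` and volume `q^{kn}` we get `ℓ = δ^{d−1} q^{kn/d}`."  [AvanziEtAl2021KyberSpec, §5.1.3]

(the printed `v`, `w` are the `x`, `y` of the definition of `Λ′`; `A ∈ ℤ_q^{m×kn}` is the matrix-LWE form
of the module instance, §5.1.2: "Given the matrix LWE instance `(A, b = As + e)`"). This file types the
OBJECTS of that paragraph for an arbitrary modulus `q` and arbitrary dimensions `m`, `n` (= the spec's
`kn`) — nothing probabilistic and no hardness content: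

* `DualAttack.lattice q A` — `Λ′ = {(x, y) ∈ ℤ^m × ℤ^n : Aᵗx ≡ y (mod q)}` as an additive subgroup of
  `ℤ^m × ℤ^n`, for `A ∈ ℤ_q^{m×n}`; `mem_lattice_iff`;
* generators: `single_graph_mem` (`(eᵢ, Aᵗeᵢ)`), `graph_mem` (`(x, Aᵗx mod q)` for every integer `x`),
  `zero_qsingle_mem` (`(0, q eⱼ)`), `qsingle_zero_mem` (`(q eᵢ, 0)`) — `Λ′` is `q`-ary;
* **`dotProduct_eq_of_mem`** — THE DISTINGUISHING IDENTITY: for `(x, y) ∈ Λ′` and `b = As + e` over `ℤ_q`,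
  `xᵗb = yᵗs + xᵗe` in `ℤ_q` (so `z` depends on the instance only through the short combination
  `yᵗs + xᵗe` of the short vectors `s, e`);
* `dotProduct_eq_of_mem'` — the same for `b = As` exactly (LWR-type / rounded instances supply their own `e`);
* **`lattice_index`** — "`Λ′` has dimension `d = m + kn` and volume `q^{kn}`": `[ℤ^m × ℤ^n : Λ′] = q^n`
  (kernel of the surjection `(x, y) ↦ Aᵗx − y mod q` onto `ℤ_q^n`).

The score statistics built on `z` (its exact null moments, the product formula under independent
coordinates, covariances) are cell-side files `Summits/Ventures/PQCStructure/Dist/DualScore*.lean`; the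
Gaussian/uniform dichotomy and the advantage `ε = 4 exp(−2π²τ²)` of the quote are heuristic estimates and
are NOT formalised.

## References

* R. Avanzi et al., *CRYSTALS-Kyber, Algorithm Specifications and Supporting Documentation* (version 3.02,
  2021-08-04): §5.1.2 "Primal attack", §5.1.3 "Dual attack" (p. 26). Held as paper:url-5bd2326281fb (p0026).
  [AvanziEtAl2021KyberSpec]
-/

namespace Literature.Computability.Cryptography

open Matrix

namespace DualAttack

variable {q : ℕ} {m n : ℕ}

/-- Reduction of an integer vector modulo `q` (coordinate-wise cast). [cite: AvanziEtAl2021KyberSpec, §5.1.3 ("mod q")] -/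
def red (q : ℕ) {κ : Type*} (x : κ → ℤ) : κ → ZMod q := fun i ↦ (x i : ZMod q)

/-- Unfolding of `red`. [cite: AvanziEtAl2021KyberSpec, §5.1.3 ("mod q")] -/
@[simp] theorem red_apply {κ : Type*} (x : κ → ℤ) (i : κ) : red q x i = (x i : ZMod q) := rfl

/-- `red` is additive. [folklore] -/
private theorem red_add {κ : Type*} (x x' : κ → ℤ) : red q (x + x') = red q x + red q x' := by
  funext i; simp

/-- `red` commutes with negation. [folklore] -/
private theorem red_neg {κ : Type*} (x : κ → ℤ) : red q (-x) = -red q x := by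
  funext i; simp

/-- `red 0 = 0`. [folklore] -/
@[simp] private theorem red_zero {κ : Type*} : red q (0 : κ → ℤ) = 0 := by
  funext i; simp

/-- **The dual lattice of the LWE instance `(A, b)`** (Kyber spec §5.1.3):
`Λ′ = {(x, y) ∈ ℤ^m × ℤ^n : Aᵗ x = y mod q}` for `A ∈ ℤ_q^{m×n}`, an additive subgroup of `ℤ^m × ℤ^n`.
[cite: AvanziEtAl2021KyberSpec, §5.1.3 (Λ′ = {(x, y) ∈ ℤ^m × ℤ^{kn} : Aᵗx = y mod q})] -/
def lattice (q : ℕ) (A : Matrix (Fin m) (Fin n) (ZMod q)) : AddSubgroup ((Fin m → ℤ) × (Fin n → ℤ)) where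
  carrier := {w | A.transpose *ᵥ red q w.1 = red q w.2}
  add_mem' := by
    intro a b ha hb
    simp only [Set.mem_setOf_eq, Prod.fst_add, Prod.snd_add] at *
    rw [red_add, red_add, Matrix.mulVec_add, ha, hb]
  zero_mem' := by
    simp only [Set.mem_setOf_eq, Prod.fst_zero, Prod.snd_zero, red_zero, Matrix.mulVec_zero]
  neg_mem' := by
    intro a ha
    simp only [Set.mem_setOf_eq, Prod.fst_neg, Prod.snd_neg] at *
    rw [red_neg, red_neg, Matrix.mulVec_neg, ha]

/-- Membership is the congruence `Aᵗ x ≡ y (mod q)`. [cite: AvanziEtAl2021KyberSpec, §5.1.3] -/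
theorem mem_lattice_iff (A : Matrix (Fin m) (Fin n) (ZMod q)) (w : (Fin m → ℤ) × (Fin n → ℤ)) :
    w ∈ lattice q A ↔ A.transpose *ᵥ red q w.1 = red q w.2 := Iff.rfl

/-! ### Generators: `Λ′` is spanned by the graph vectors `(x, Aᵗx)` and the `q`-vectors `(0, q eⱼ)` -/

/-- For every integer `x ∈ ℤ^m` and any integer representative `y` of `Aᵗx mod q`, `(x, y) ∈ Λ′`; in
particular with the canonical representatives in `[0, q)`. [cite: AvanziEtAl2021KyberSpec, §5.1.3] -/
theorem graph_mem [NeZero q] (A : Matrix (Fin m) (Fin n) (ZMod q)) (x : Fin m → ℤ) :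
    (x, fun j ↦ (((A.transpose *ᵥ red q x) j).val : ℤ)) ∈ lattice q A := by
  rw [mem_lattice_iff]
  funext j
  simp

/-- The graph vector of a basis vector: `(eᵢ, Aᵗeᵢ mod q) ∈ Λ′` (column `i` of `Aᵗ` = row `i` of `A`).
[cite: AvanziEtAl2021KyberSpec, §5.1.3] -/
theorem single_graph_mem [NeZero q] (A : Matrix (Fin m) (Fin n) (ZMod q)) (i : Fin m) :
    (Pi.single i 1, fun j ↦ ((A i j).val : ℤ)) ∈ lattice q A := by
  rw [mem_lattice_iff]
  have h1 : red q (Pi.single i (1 : ℤ) : Fin m → ℤ) = Pi.single i 1 := by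
    funext i'
    by_cases h : i' = i
    · subst h; simp
    · simp [Pi.single_eq_of_ne h]
  rw [h1, Matrix.mulVec_single_one]
  funext j
  simp [Matrix.col_apply, Matrix.transpose_apply]

/-- `q`-ary in the `y` block: `(0, q eⱼ) ∈ Λ′`. [cite: AvanziEtAl2021KyberSpec, §5.1.3 (volume q^{kn})] -/
theorem zero_qsingle_mem (A : Matrix (Fin m) (Fin n) (ZMod q)) (j : Fin n) :
    ((0 : Fin m → ℤ), Pi.single j (q : ℤ)) ∈ lattice q A := by
  rw [mem_lattice_iff]
  simp only [red_zero, Matrix.mulVec_zero]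
  funext j'
  by_cases h : j' = j
  · subst h; simp
  · simp [Pi.single_eq_of_ne h]

/-- `q`-ary in the `x` block as well: `(q eᵢ, 0) ∈ Λ′`. [cite: AvanziEtAl2021KyberSpec, §5.1.3] -/
theorem qsingle_zero_mem (A : Matrix (Fin m) (Fin n) (ZMod q)) (i : Fin m) :
    (Pi.single i (q : ℤ), (0 : Fin n → ℤ)) ∈ lattice q A := by
  rw [mem_lattice_iff]
  have h1 : red q (Pi.single i (q : ℤ) : Fin m → ℤ) = 0 := by
    funext i'
    by_cases h : i' = i
    · subst h; simp
    · simp [Pi.single_eq_of_ne h]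
  rw [h1, Matrix.mulVec_zero, red_zero]

/-- Every `q`-multiple lies in `Λ′`: `q·(ℤ^m × ℤ^n) ⊆ Λ′`. [cite: AvanziEtAl2021KyberSpec, §5.1.3] -/
theorem qsmul_mem (A : Matrix (Fin m) (Fin n) (ZMod q)) (w : (Fin m → ℤ) × (Fin n → ℤ)) :
    (q : ℤ) • w ∈ lattice q A := by
  rw [mem_lattice_iff]
  have h1 : red q ((q : ℤ) • w).1 = 0 := by funext i; simp
  have h2 : red q ((q : ℤ) • w).2 = 0 := by funext i; simp
  rw [h1, h2, Matrix.mulVec_zero]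

/-! ### The distinguishing identity -/

/-- **`z = xᵗb = yᵗs + xᵗe (mod q)`**: for `(x, y) ∈ Λ′` and an LWE right-hand side `b = A s + e` over
`ℤ_q`, the dual score input `⟨x, b⟩` equals `⟨y, s⟩ + ⟨x, e⟩` — a combination of the SHORT vectors
`s, e` with the SHORT coefficients `y, x` (the quote's "`z = vᵗ·b = vᵗAs + vᵗe = wᵗs + vᵗe mod q`").
[cite: AvanziEtAl2021KyberSpec, §5.1.3 (z = vᵗ·b = vᵗAs + vᵗe = wᵗs + vᵗe mod q)] -/
theorem dotProduct_eq_of_mem {A : Matrix (Fin m) (Fin n) (ZMod q)} {w : (Fin m → ℤ) × (Fin n → ℤ)}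
    (hw : w ∈ lattice q A) (s : Fin n → ZMod q) (e b : Fin m → ZMod q) (hb : b = A *ᵥ s + e) :
    red q w.1 ⬝ᵥ b = red q w.2 ⬝ᵥ s + red q w.1 ⬝ᵥ e := by
  rw [mem_lattice_iff] at hw
  rw [hb, dotProduct_add, Matrix.dotProduct_mulVec, ← Matrix.mulVec_transpose, hw]

/-- The same for an exact product `b = A s` (no additive error; e.g. the unrounded part of an LWR
instance): `xᵗ(As) = yᵗs`. [cite: AvanziEtAl2021KyberSpec, §5.1.3] -/
theorem dotProduct_mulVec_eq_of_mem {A : Matrix (Fin m) (Fin n) (ZMod q)} {w : (Fin m → ℤ) × (Fin n → ℤ)}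
    (hw : w ∈ lattice q A) (s : Fin n → ZMod q) :
    red q w.1 ⬝ᵥ (A *ᵥ s) = red q w.2 ⬝ᵥ s := by
  have h := dotProduct_eq_of_mem hw s 0 (A *ᵥ s) (by rw [add_zero])
  rwa [dotProduct_zero, add_zero] at h

/-- Consequently two right-hand sides with the SAME error and secrets `s, s'` give scores differing by
`yᵗ(s − s')`, and for `x` with `Aᵗx ≡ 0` (i.e. `(x, 0) ∈ Λ′`, the unscaled dual attack) the score
`xᵗb = xᵗe` does not depend on `s` at all. [cite: AvanziEtAl2021KyberSpec, §5.1.3] -/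
theorem dotProduct_eq_of_mem_zero {A : Matrix (Fin m) (Fin n) (ZMod q)} {x : Fin m → ℤ}
    (hx : (x, (0 : Fin n → ℤ)) ∈ lattice q A) (s : Fin n → ZMod q) (e : Fin m → ZMod q) :
    red q x ⬝ᵥ (A *ᵥ s + e) = red q x ⬝ᵥ e := by
  have h := dotProduct_eq_of_mem hx s e _ rfl
  rw [h]
  simp

/-! ### Volume: `[ℤ^m × ℤ^n : Λ′] = q^n` -/

/-- The map `(x, y) ↦ Aᵗx − y (mod q)` whose kernel is `Λ′`. [cite: AvanziEtAl2021KyberSpec, §5.1.3] -/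
def subMap (A : Matrix (Fin m) (Fin n) (ZMod q)) : ((Fin m → ℤ) × (Fin n → ℤ)) →+ (Fin n → ZMod q) where
  toFun w := A.transpose *ᵥ red q w.1 - red q w.2
  map_zero' := by simp
  map_add' a b := by
    simp only [Prod.fst_add, Prod.snd_add, red_add, Matrix.mulVec_add]
    abel

/-- `Λ′ = ker ((x, y) ↦ Aᵗx − y mod q)`. [cite: AvanziEtAl2021KyberSpec, §5.1.3] -/
theorem ker_subMap (A : Matrix (Fin m) (Fin n) (ZMod q)) : (subMap A).ker = lattice q A := by
  ext w
  rw [AddMonoidHom.mem_ker, mem_lattice_iff]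
  exact sub_eq_zero

/-- `(x, y) ↦ Aᵗx − y mod q` is onto `ℤ_q^n` (already on `x = 0`). [cite: AvanziEtAl2021KyberSpec, §5.1.3] -/
theorem subMap_surjective [NeZero q] (A : Matrix (Fin m) (Fin n) (ZMod q)) :
    Function.Surjective (subMap A) := by
  intro a
  refine ⟨((0 : Fin m → ℤ), fun j ↦ -(((a j).val : ℤ))), ?_⟩
  show A.transpose *ᵥ red q (0 : Fin m → ℤ) - red q (fun j ↦ -(((a j).val : ℤ))) = a
  rw [red_zero, Matrix.mulVec_zero, zero_sub]
  funext j
  simp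

/-- **"`Λ′` has dimension `d = m + kn` and volume `q^{kn}`"**: `Λ′` has index `q^n` in `ℤ^m × ℤ^n`
(full rank `m + n`, covolume `q^n`), for EVERY `A ∈ ℤ_q^{m×n}`. [cite: AvanziEtAl2021KyberSpec, §5.1.3 (Λ′ has dimension d = m + kn and volume q^{kn})] -/
theorem lattice_index [NeZero q] (A : Matrix (Fin m) (Fin n) (ZMod q)) : (lattice q A).index = q ^ n := by
  rw [← ker_subMap, AddSubgroup.index_ker, AddMonoidHom.range_eq_top_of_surjective _ (subMap_surjective A),
    AddSubgroup.card_top, Nat.card_fun, Nat.card_zmod, Nat.card_eq_fintype_card, Fintype.card_fin]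

end DualAttack

end Literature.Computability.Cryptography
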